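import Summits.AtomisticToContinuum.HydrodynamicLimit.Theorems.InformationPercolationEngineChaosClosesEulerReductionFields
import HarnessLib

/-!
# Weak stress isotropy in band (crux `ChaosClosesEuler`, stmt-AtomisticToContinuum-15141, line `Sketch`,
# stub `stub_stressIsotropyOfLocalEquilibrium`) — helper A: cone `ψ`-moments, velocity tails, state identities

WHAT. Pathwise, pointwise bookkeeping for ONE configuration `w` and ONE centre `x`:

* `MpsiC r w x ψ = ∫ b_r(q.1, x) ψ(q.2) dμ_w` — the cone-weighted empirical `ψ`-moment (DEFINITIONALLY the `Mψ` of
  `PointwiseLocalEquilibrium`), its particle-sum form, monotonicity, `x`-continuity and `∫ₓ MpsiC ψ = (N+1)⁻¹Σᵢψ(vᵢ)`;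
* the velocity tails `sqTail M v = ‖v‖² 1{M < ‖v‖}`, `cubeTail M v = ‖v‖³ 1{M < ‖v‖}` (the mark of
  `TwoClocks.EnergyCurrentTails`) and `e_r ≤ (M²/2)ρ_r + ½ MpsiC (sqTail M)`;
* the state identities `m_r = ρ_r u_r`, `ρ_r‖u_r‖² ≤ 2e_r`, `ρ_r(‖u_r‖² + 3θ_r) = 2e_r`.

(The bulk cut-off and the non-bulk bound are in helper B.)  No named fact is invoked.
-/

noncomputable section

namespace Summit.AtomisticToContinuum.HydrodynamicLimit.Theorems.ChaosClosesEulerStressIsotropy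

open scoped BigOperators Topology Classical MeasureTheory ENNReal InnerProductSpace
open Filter Set MeasureTheory Function
open Literature.MathematicalPhysics.KineticTheory
open Literature.Analysis.FluidPDE
open Literature.Analysis.FunctionSpaces
open Summit.AtomisticToContinuum.HydrodynamicLimit.Theorems.LocalSecondLawNegative
open Summit.AtomisticToContinuum.HydrodynamicLimit.Theorems.LocalSecondLawLedger
open Summit.AtomisticToContinuum.HydrodynamicLimit.Theorems.LocalSecondLawLedger.L
  (Mmom rhoC_eq_sum momC_apply_eq_sum momC_eq_sum uC_apply norm_sq_eq_sum)
open Summit.AtomisticToContinuum.HydrodynamicLimit.Theorems.ChaosClosesEulerReduction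

variable {N : ℕ}

/-! ## §1 Cone-weighted empirical `ψ`-moments -/

/-- The cone-weighted empirical `ψ`-moment `∫ b_r(q.1, x) ψ(q.2) dμ_w` (the `Mψ` of `PointwiseLocalEquilibrium`).
[folklore] -/
def MpsiC (r : ℝ) (w : Phase N) (x : T3) (ψ : V3 → ℝ) : ℝ :=
  ∫ q, cone r q.1 x * ψ q.2 ∂(empiricalMeasure w)

/-- Particle-sum form of the `ψ`-moment. [folklore] -/
theorem MpsiC_eq_sum (r : ℝ) (w : Phase N) (x : T3) (ψ : V3 → ℝ) :
    MpsiC r w x ψ = ((N + 1 : ℕ) : ℝ)⁻¹ * ∑ i, cone r (w i).1 x * ψ (w i).2 := by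
  unfold MpsiC; rw [integral_empiricalMeasure]

/-- Monotonicity of the `ψ`-moment in `ψ`. [folklore] -/
theorem MpsiC_mono {r : ℝ} (hr : 0 < r) (w : Phase N) (x : T3) {ψ ψ' : V3 → ℝ} (h : ∀ v, ψ v ≤ ψ' v) :
    MpsiC r w x ψ ≤ MpsiC r w x ψ' := by
  rw [MpsiC_eq_sum, MpsiC_eq_sum]
  exact mul_le_mul_of_nonneg_left (Finset.sum_le_sum fun i _ =>
    mul_le_mul_of_nonneg_left (h _) (cone_nonneg hr _ _)) (by positivity)

/-- Nonnegativity of the `ψ`-moment of a nonnegative `ψ`. [folklore] -/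
theorem MpsiC_nonneg {r : ℝ} (hr : 0 < r) (w : Phase N) (x : T3) {ψ : V3 → ℝ} (h : ∀ v, 0 ≤ ψ v) :
    0 ≤ MpsiC r w x ψ := by
  rw [MpsiC_eq_sum]
  exact mul_nonneg (by positivity) (Finset.sum_nonneg fun i _ => mul_nonneg (cone_nonneg hr _ _) (h _))

/-- `|MpsiC ψ| ≤ MpsiC ψ'` when `|ψ| ≤ ψ'`. [folklore] -/
theorem abs_MpsiC_le {r : ℝ} (hr : 0 < r) (w : Phase N) (x : T3) {ψ ψ' : V3 → ℝ} (h : ∀ v, |ψ v| ≤ ψ' v) :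
    |MpsiC r w x ψ| ≤ MpsiC r w x ψ' := by
  rw [MpsiC_eq_sum, MpsiC_eq_sum, abs_mul, abs_of_nonneg (by positivity : (0 : ℝ) ≤ ((N + 1 : ℕ) : ℝ)⁻¹)]
  refine mul_le_mul_of_nonneg_left ((Finset.abs_sum_le_sum_abs _ _).trans
    (Finset.sum_le_sum fun i _ => ?_)) (by positivity)
  rw [abs_mul, abs_of_nonneg (cone_nonneg hr _ _)]
  exact mul_le_mul_of_nonneg_left (h _) (cone_nonneg hr _ _)

/-- Additivity of the `ψ`-moment. [folklore] -/
theorem MpsiC_add (r : ℝ) (w : Phase N) (x : T3) (ψ ψ' : V3 → ℝ) :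
    MpsiC r w x (fun v => ψ v + ψ' v) = MpsiC r w x ψ + MpsiC r w x ψ' := by
  rw [MpsiC_eq_sum, MpsiC_eq_sum, MpsiC_eq_sum, ← mul_add, ← Finset.sum_add_distrib]
  congr 1
  exact Finset.sum_congr rfl fun i _ => by ring

/-- The `ψ`-moment of a difference. [folklore] -/
theorem MpsiC_sub (r : ℝ) (w : Phase N) (x : T3) (ψ ψ' : V3 → ℝ) :
    MpsiC r w x (fun v => ψ v - ψ' v) = MpsiC r w x ψ - MpsiC r w x ψ' := by
  rw [MpsiC_eq_sum, MpsiC_eq_sum, MpsiC_eq_sum, ← mul_sub, ← Finset.sum_sub_distrib]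
  congr 1
  exact Finset.sum_congr rfl fun i _ => by ring

/-- Homogeneity of the `ψ`-moment. [folklore] -/
theorem MpsiC_const_mul (r : ℝ) (w : Phase N) (x : T3) (c : ℝ) (ψ : V3 → ℝ) :
    MpsiC r w x (fun v => c * ψ v) = c * MpsiC r w x ψ := by
  rw [MpsiC_eq_sum, MpsiC_eq_sum, Finset.mul_sum, Finset.mul_sum, Finset.mul_sum]
  exact Finset.sum_congr rfl fun i _ => by ring

/-- The mollified density is the moment of `1`. [folklore] -/
theorem rhoC_eq_MpsiC (r : ℝ) (w : Phase N) (x : T3) : rhoC r w x = MpsiC r w x (fun _ => 1) := by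
  rw [rhoC_eq_sum, MpsiC_eq_sum]; simp only [mul_one]

/-- `|MpsiC ψ| ≤ C ρ_r` when `|ψ| ≤ C`. [folklore] -/
theorem abs_MpsiC_le_mul_rhoC {r : ℝ} (hr : 0 < r) (w : Phase N) (x : T3) {ψ : V3 → ℝ} {C : ℝ}
    (h : ∀ v, |ψ v| ≤ C) : |MpsiC r w x ψ| ≤ C * rhoC r w x := by
  have h1 := abs_MpsiC_le hr w x (ψ := ψ) (ψ' := fun _ => C * 1) (fun v => by rw [mul_one]; exact h v)
  rwa [MpsiC_const_mul, ← rhoC_eq_MpsiC] at h1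

/-- The second moments are `ψ`-moments. [folklore] -/
theorem Mmom_eq_MpsiC (r : ℝ) (w : Phase N) (x : T3) (j k : Fin 3) :
    Mmom r w x j k = MpsiC r w x (fun v => v j * v k) := by
  rw [MpsiC_eq_sum]; rfl

/-- Twice the mollified kinetic energy is the moment of `‖v‖²`. [folklore] -/
theorem two_mul_kinC_eq_MpsiC (r : ℝ) (w : Phase N) (x : T3) :
    2 * kinC r w x = MpsiC r w x (fun v => ‖v‖ ^ 2) := by
  rw [kinC_eq_sum, MpsiC_eq_sum, mul_left_comm, Finset.mul_sum, Finset.mul_sum, Finset.mul_sum]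
  exact Finset.sum_congr rfl fun i _ => by ring

/-- The `ψ`-moment is continuous in the centre. [folklore] -/
theorem continuous_MpsiC (r : ℝ) (w : Phase N) (ψ : V3 → ℝ) : Continuous fun x => MpsiC r w x ψ := by
  have h : (fun x => MpsiC r w x ψ) = fun x => ((N + 1 : ℕ) : ℝ)⁻¹ * ∑ i, cone r (w i).1 x * ψ (w i).2 :=
    funext fun x => MpsiC_eq_sum r w x ψ
  rw [h]
  exact continuous_const.mul (continuous_finsetSum _ fun i _ => (continuous_cone r _).mul continuous_const)

/-- **Unit cone mass**: `∫ₓ MpsiC ψ dx = (N+1)⁻¹ Σᵢ ψ(vᵢ)` for `0 < r < 1/2`. [folklore] -/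
theorem integral_MpsiC {r : ℝ} (hr : 0 < r) (hr2 : r < 1 / 2) (w : Phase N) (ψ : V3 → ℝ) :
    ∫ x, MpsiC r w x ψ = ((N + 1 : ℕ) : ℝ)⁻¹ * ∑ i, ψ (w i).2 := by
  have hfun : (fun x => MpsiC r w x ψ) = fun x => ((N + 1 : ℕ) : ℝ)⁻¹ * ∑ i, cone r (w i).1 x * ψ (w i).2 :=
    funext fun x => MpsiC_eq_sum r w x ψ
  rw [hfun, integral_const_mul, integral_finsetSum Finset.univ (f := fun i a => cone r (w i).1 a * ψ (w i).2)
    (fun i _ => integrable_of_continuous_T3 ((continuous_cone r _).mul continuous_const))]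
  congr 1
  refine Finset.sum_congr rfl fun i _ => ?_
  have h1 : ∫ a, cone r (w i).1 a = 1 := integral_cone_eq_one hr hr2 (w i).1
  rw [integral_mul_const, h1, one_mul]

/-! ## §2 Velocity tails and the energy split at speed `M` -/

/-- The quadratic speed tail `‖v‖² 1{M < ‖v‖}`. [folklore] -/
def sqTail (M : ℝ) (v : V3) : ℝ := Set.indicator {v : V3 | M < ‖v‖} (fun v => ‖v‖ ^ 2) v

/-- The cubic speed tail `‖v‖³ 1{M < ‖v‖}` (the mark of `TwoClocks.EnergyCurrentTails`). [folklore] -/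
def cubeTail (M : ℝ) (v : V3) : ℝ := Set.indicator {v : V3 | M < ‖v‖} (fun v => ‖v‖ ^ 3) v

/-- The quadratic tail is nonnegative. [folklore] -/
theorem sqTail_nonneg (M : ℝ) (v : V3) : 0 ≤ sqTail M v :=
  Set.indicator_nonneg (fun _ _ => by positivity) _

/-- The cubic tail is nonnegative. [folklore] -/
theorem cubeTail_nonneg (M : ℝ) (v : V3) : 0 ≤ cubeTail M v :=
  Set.indicator_nonneg (fun _ _ => by positivity) _

/-- Above speed `1` the quadratic tail is below the cubic tail. [folklore] -/
theorem sqTail_le_cubeTail {M : ℝ} (hM : 1 ≤ M) (v : V3) : sqTail M v ≤ cubeTail M v := by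
  unfold sqTail cubeTail
  by_cases h : M < ‖v‖
  · rw [Set.indicator_of_mem (show v ∈ {v : V3 | M < ‖v‖} from h),
      Set.indicator_of_mem (show v ∈ {v : V3 | M < ‖v‖} from h)]
    have h1 : 1 ≤ ‖v‖ := hM.trans h.le
    nlinarith [sq_nonneg ‖v‖]
  · rw [Set.indicator_of_notMem (show v ∉ {v : V3 | M < ‖v‖} from h),
      Set.indicator_of_notMem (show v ∉ {v : V3 | M < ‖v‖} from h)]

/-- The quadratic tail decreases with the level. [folklore] -/
theorem sqTail_antitone {M M' : ℝ} (hMM : M ≤ M') (v : V3) : sqTail M' v ≤ sqTail M v := by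
  by_cases h : M' < ‖v‖
  · unfold sqTail
    rw [Set.indicator_of_mem (show v ∈ {v : V3 | M' < ‖v‖} from h),
      Set.indicator_of_mem (show v ∈ {v : V3 | M < ‖v‖} from hMM.trans_lt h)]
  · have h0 : sqTail M' v = 0 := Set.indicator_of_notMem (show v ∉ {v : V3 | M' < ‖v‖} from h) _
    rw [h0]
    exact sqTail_nonneg M v

/-- The energy split at speed `M`: `‖v‖² ≤ M² + ‖v‖² 1{M < ‖v‖}`. [folklore] -/
theorem norm_sq_le_add_sqTail (M : ℝ) (v : V3) : ‖v‖ ^ 2 ≤ M ^ 2 + sqTail M v := by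
  unfold sqTail
  by_cases h : M < ‖v‖
  · rw [Set.indicator_of_mem (show v ∈ {v : V3 | M < ‖v‖} from h)]
    linarith [sq_nonneg M]
  · rw [Set.indicator_of_notMem (show v ∉ {v : V3 | M < ‖v‖} from h), add_zero]
    rw [not_lt] at h
    exact pow_le_pow_left₀ (norm_nonneg _) h 2

/-- A soft tail below level `M` is dominated by the hard tail: `c ≤ 1`, `c = 0` whenever `‖v‖ ≤ M` gives
`‖v‖² c ≤ sqTail M v`. [folklore] -/
theorem norm_sq_mul_le_sqTail {M : ℝ} {v : V3} {c : ℝ} (hc1 : c ≤ 1) (hcM : ‖v‖ ≤ M → c = 0) :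
    ‖v‖ ^ 2 * c ≤ sqTail M v := by
  unfold sqTail
  by_cases h : M < ‖v‖
  · rw [Set.indicator_of_mem (show v ∈ {v : V3 | M < ‖v‖} from h)]
    nlinarith [sq_nonneg ‖v‖]
  · rw [Set.indicator_of_notMem (show v ∉ {v : V3 | M < ‖v‖} from h), hcM (not_lt.1 h), mul_zero]

/-- The quadratic tail is measurable. [folklore] -/
theorem measurable_sqTail (M : ℝ) : Measurable (sqTail M) := by
  unfold sqTail
  exact (continuous_norm.pow 2).measurable.indicator (measurableSet_lt measurable_const continuous_norm.measurable)

/-- The cubic tail is measurable. [folklore] -/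
theorem measurable_cubeTail (M : ℝ) : Measurable (cubeTail M) := by
  unfold cubeTail
  exact (continuous_norm.pow 3).measurable.indicator (measurableSet_lt measurable_const continuous_norm.measurable)

/-- **Energy split of the cone field**: `e_r ≤ (M²/2) ρ_r + ½ MpsiC (sqTail M)`. [folklore] -/
theorem kinC_le_add_tail {r : ℝ} (hr : 0 < r) (w : Phase N) (x : T3) (M : ℝ) :
    kinC r w x ≤ M ^ 2 / 2 * rhoC r w x + MpsiC r w x (sqTail M) / 2 := by
  have h2 := two_mul_kinC_eq_MpsiC r w x
  have h := MpsiC_mono hr w x (ψ := fun v => ‖v‖ ^ 2) (ψ' := fun v => M ^ 2 * 1 + sqTail M v)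
    (fun v => by rw [mul_one]; exact norm_sq_le_add_sqTail M v)
  rw [MpsiC_add, MpsiC_const_mul, ← rhoC_eq_MpsiC] at h
  linarith

/-- The quadratic tail is below `‖v‖²`. [folklore] -/
theorem sqTail_le_norm_sq (M : ℝ) (v : V3) : sqTail M v ≤ ‖v‖ ^ 2 := by
  unfold sqTail
  by_cases h : M < ‖v‖
  · rw [Set.indicator_of_mem (show v ∈ {v : V3 | M < ‖v‖} from h)]
  · rw [Set.indicator_of_notMem (show v ∉ {v : V3 | M < ‖v‖} from h)]; positivity

/-- The mean quadratic tail of a configuration is at most twice its mean kinetic energy. [folklore] -/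
theorem mean_sqTail_le_two_ke (M : ℝ) (w : Phase N) :
    ((N + 1 : ℕ) : ℝ)⁻¹ * ∑ i, sqTail M (w i).2 ≤ 2 * ke w := by
  have h : ∑ i, sqTail M (w i).2 ≤ ∑ i, ‖(w i).2‖ ^ 2 := Finset.sum_le_sum fun i _ => sqTail_le_norm_sq M _
  have h2 : 2 * ke w = ((N + 1 : ℕ) : ℝ)⁻¹ * ∑ i, ‖(w i).2‖ ^ 2 := by
    unfold ke; rw [← Finset.sum_div]; ring
  rw [h2]
  exact mul_le_mul_of_nonneg_left h (by positivity)

/-! ## §3 State identities -/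

/-- Off the empty cone the momentum is density times velocity. [folklore] -/
theorem momC_eq_rhoC_smul_uC {r : ℝ} {w : Phase N} {x : T3} (h : rhoC r w x ≠ 0) :
    momC r w x = rhoC r w x • uC r w x := by
  unfold uC; rw [smul_smul, mul_inv_cancel₀ h, one_smul]

/-- Components: `mⱼ = ρ_r uⱼ` off the empty cone. [folklore] -/
theorem momC_apply_eq_rhoC_mul {r : ℝ} {w : Phase N} {x : T3} (h : rhoC r w x ≠ 0) (j : Fin 3) :
    momC r w x j = rhoC r w x * uC r w x j := by
  rw [uC_apply, ← mul_assoc, mul_inv_cancel₀ h, one_mul]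

/-- `mⱼmₖ/ρ_r = ρ_r uⱼuₖ` off the empty cone. [folklore] -/
theorem momC_mul_momC_div {r : ℝ} {w : Phase N} {x : T3} (h : rhoC r w x ≠ 0) (j k : Fin 3) :
    momC r w x j * momC r w x k / rhoC r w x = rhoC r w x * (uC r w x j * uC r w x k) := by
  rw [momC_apply_eq_rhoC_mul h, momC_apply_eq_rhoC_mul h]
  field_simp

/-- **Admissibility through the velocity**: `ρ_r ‖u_r‖² ≤ 2 e_r`. [folklore] -/
theorem rhoC_mul_norm_uC_sq_le {r : ℝ} (hr : 0 < r) (w : Phase N) (x : T3) :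
    rhoC r w x * ‖uC r w x‖ ^ 2 ≤ 2 * kinC r w x := by
  by_cases h : rhoC r w x = 0
  · rw [h, zero_mul]; linarith [kinC_nonneg hr w x]
  · have hρ : 0 < rhoC r w x := lt_of_le_of_ne (rhoC_nonneg hr w x) (Ne.symm h)
    have hcs := norm_momC_sq_le hr w x
    rw [momC_eq_rhoC_smul_uC h, norm_smul, mul_pow, Real.norm_eq_abs, sq_abs] at hcs
    have h2 : rhoC r w x * (rhoC r w x * ‖uC r w x‖ ^ 2) ≤ rhoC r w x * (2 * kinC r w x) := by
      calc _ = rhoC r w x ^ 2 * ‖uC r w x‖ ^ 2 := by ring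
        _ ≤ 2 * rhoC r w x * kinC r w x := hcs
        _ = _ := by ring
    exact le_of_mul_le_mul_left h2 hρ

/-- **The temperature identity**: `ρ_r(‖u_r‖² + 3θ_r) = 2e_r` off the empty cone. [folklore] -/
theorem rhoC_mul_norm_uC_sq_add {r : ℝ} {w : Phase N} {x : T3} (h : rhoC r w x ≠ 0) :
    rhoC r w x * (‖uC r w x‖ ^ 2 + 3 * thetaC r w x) = 2 * kinC r w x := by
  have h1 := psvK_rhoC_mul_thetaC h
  have h2 : ‖momC r w x‖ ^ 2 = rhoC r w x ^ 2 * ‖uC r w x‖ ^ 2 := by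
    rw [momC_eq_rhoC_smul_uC h, norm_smul, mul_pow, Real.norm_eq_abs, sq_abs]
  rw [h2] at h1
  have h3 : rhoC r w x ^ 2 * ‖uC r w x‖ ^ 2 / (2 * rhoC r w x) = rhoC r w x * ‖uC r w x‖ ^ 2 / 2 := by
    field_simp
  rw [h3] at h1
  linarith


/-! ## §4 Small velocity algebra -/

/-- `|vⱼ vₖ| ≤ ‖v‖²` on `ℝ³` (each coordinate is bounded by the norm, `PiLp.norm_apply_le`). [folklore] -/
theorem abs_apply_mul_apply_le (v : V3) (j k : Fin 3) : |v j * v k| ≤ ‖v‖ ^ 2 := by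
  have hj : |v j| ≤ ‖v‖ := by simpa using PiLp.norm_apply_le v j
  have hk : |v k| ≤ ‖v‖ := by simpa using PiLp.norm_apply_le v k
  rw [abs_mul, sq]
  exact mul_le_mul hj hk (abs_nonneg _) (norm_nonneg _)

/-- The mean kinetic energy through `configEnergy`: `ke w = (N+1)⁻¹ E(w)`. [folklore] -/
theorem ke_eq_configEnergy (w : Phase N) : ke w = ((N + 1 : ℕ) : ℝ)⁻¹ * configEnergy w := by
  unfold ke configEnergy
  rw [← Finset.sum_div]
  ring

/-- One particle's speed squared is at most `2(N+1) ke`. [folklore] -/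
theorem norm_sq_le_ke (w : Phase N) (i : Fin (N + 1)) : ‖(w i).2‖ ^ 2 ≤ 2 * ((N + 1 : ℕ) : ℝ) * ke w := by
  have h1 : ‖(w i).2‖ ^ 2 / 2 ≤ ∑ j, ‖(w j).2‖ ^ 2 / 2 :=
    Finset.single_le_sum (f := fun j => ‖(w j).2‖ ^ 2 / 2) (fun j _ => by positivity) (Finset.mem_univ i)
  have hN : (0 : ℝ) < ((N + 1 : ℕ) : ℝ) := by positivity
  unfold ke
  rw [← mul_assoc, mul_assoc 2, mul_inv_cancel₀ hN.ne', mul_one]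
  linarith

/-- One particle's speed is at most `√(2(N+1) ke)`. [folklore] -/
theorem norm_le_sqrt_ke (w : Phase N) (i : Fin (N + 1)) :
    ‖(w i).2‖ ≤ Real.sqrt (2 * ((N + 1 : ℕ) : ℝ) * ke w) :=
  Real.le_sqrt_of_sq_le (norm_sq_le_ke w i)

/-- The cubic tail is below `‖v‖³`. [folklore] -/
theorem cubeTail_le_norm_cube (M : ℝ) (v : V3) : cubeTail M v ≤ ‖v‖ ^ 3 := by
  unfold cubeTail
  by_cases h : M < ‖v‖
  · rw [Set.indicator_of_mem (show v ∈ {v : V3 | M < ‖v‖} from h)]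
  · rw [Set.indicator_of_notMem (show v ∉ {v : V3 | M < ‖v‖} from h)]; positivity

/-- **A-priori bound of the mean cubic tail of a configuration**: `(N+1)⁻¹Σᵢ cubeTail M vᵢ ≤ 2 ke √(2(N+1) ke)`
(every speed is at most `√(2(N+1) ke)`). [folklore] -/
theorem mean_cubeTail_le (M : ℝ) (w : Phase N) :
    ((N + 1 : ℕ) : ℝ)⁻¹ * ∑ i, cubeTail M (w i).2 ≤ 2 * ke w * Real.sqrt (2 * ((N + 1 : ℕ) : ℝ) * ke w) := by
  set S := Real.sqrt (2 * ((N + 1 : ℕ) : ℝ) * ke w) with hS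
  have hS0 : 0 ≤ S := Real.sqrt_nonneg _
  have hpt : ∀ i : Fin (N + 1), cubeTail M (w i).2 ≤ ‖(w i).2‖ ^ 2 * S := fun i =>
    calc cubeTail M (w i).2 ≤ ‖(w i).2‖ ^ 3 := cubeTail_le_norm_cube M _
      _ = ‖(w i).2‖ ^ 2 * ‖(w i).2‖ := by ring
      _ ≤ ‖(w i).2‖ ^ 2 * S := mul_le_mul_of_nonneg_left (norm_le_sqrt_ke w i) (by positivity)
  have h2 : 2 * ke w = ((N + 1 : ℕ) : ℝ)⁻¹ * ∑ i, ‖(w i).2‖ ^ 2 := by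
    unfold ke; rw [← Finset.sum_div]; ring
  calc ((N + 1 : ℕ) : ℝ)⁻¹ * ∑ i, cubeTail M (w i).2 ≤ ((N + 1 : ℕ) : ℝ)⁻¹ * ∑ i, ‖(w i).2‖ ^ 2 * S :=
        mul_le_mul_of_nonneg_left (Finset.sum_le_sum fun i _ => hpt i) (by positivity)
    _ = 2 * ke w * S := by rw [h2, ← Finset.sum_mul]; ring

/-- Above speed `1` the mean quadratic tail is below the mean cubic tail. [folklore] -/
theorem mean_sqTail_le_mean_cubeTail {M : ℝ} (hM : 1 ≤ M) (w : Phase N) :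
    ((N + 1 : ℕ) : ℝ)⁻¹ * ∑ i, sqTail M (w i).2 ≤ ((N + 1 : ℕ) : ℝ)⁻¹ * ∑ i, cubeTail M (w i).2 :=
  mul_le_mul_of_nonneg_left (Finset.sum_le_sum fun i _ => sqTail_le_cubeTail hM _) (by positivity)

/-! ## §5 Registered sub-goal -/

/-- **Registered sub-goal `stub_stressIsotropyTails` (helper A of `stub_stressIsotropyOfLocalEquilibrium`): the energy
split of the cone field at speed `M`**, `e_r ≤ (M²/2)ρ_r + ½ ∫ b_r ‖v‖² 1{M < ‖v‖} dμ_w` — the source of every velocity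
tail of the stress-isotropy bookkeeping. [folklore] -/
theorem stub_stressIsotropyTails : ∀ {N : ℕ} {r : ℝ}, 0 < r → ∀ (w : Config (N + 1) (Fin 3) T3) (x : T3) (M : ℝ), kinC r w x ≤ M ^ 2 / 2 * rhoC r w x + (∫ q, cone r q.1 x * Set.indicator {v : V3 | M < ‖v‖} (fun v => ‖v‖ ^ 2) q.2 ∂(empiricalMeasure w)) / 2 :=
  fun hr w x M => kinC_le_add_tail hr w x M

end Summit.AtomisticToContinuum.HydrodynamicLimit.Theorems.ChaosClosesEulerStressIsotropy

end
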